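import Summits.BirchSwinnertonDyer.BirchSwinnertonDyer.Theorems.ClassRecordThreeShimuraUpperHalf
import Summits.BirchSwinnertonDyer.BirchSwinnertonDyer.Theorems.ErratumRoadFiveShimuraSkolemPackageCoker
import Summits.BirchSwinnertonDyer.BirchSwinnertonDyer.Theorems.RamifiedHeegnerPairLeafShimuraInertTools
import Summits.BirchSwinnertonDyer.Rank1Residual.Additive.LocIrrOddPrimes
import Summits.BirchSwinnertonDyer.Rank1Residual.X11b.Three.UpperHalfShimuraCore
import HarnessLib

/-!
# Route `RamifiedHeegnerPair`, crux U₁ `LeafRankOneUpperAtThree` (stmt-BirchSwinnertonDyer-26022), line `splitkolyvagin` —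
# the INERT-CARRIER (Shimura-curve) road, part 2: the Euler-system half at ONE Jetchev–Skinner–Wan datum, from PUBLISHED named facts
# and the partner's lower half — NO divisibility of Kolyvagin classes (no Σ-stub) on the rows it serves

HONEST FRAMING. Theorems only; helper file (`--supports stmt-BirchSwinnertonDyer-26022 --as helper`); nothing is booked, no item is
closed, BSD is not proved for any curve; CONDITIONAL on every displayed input (named facts of the tree taken as hypotheses; at
`3 ∣ N⁺` the Kolyvagin conjunct of `shimuraCurve_heegnerPoint_grossZagier_kolyvagin` is JSW 2017 Thm. 4.4.1 AS PRINTED — reading flag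
`JSW17-Thm441-Nekovar-primary`, exactly as for the X11b consumers). Lead prover bsd-line-rhp-p2 g10, 2026-08-28.

WHAT. Team x11b3's Shimura road for class X11b at `p = 3` (`Theorems/ClassRecordThreeShimuraUpperHalf.lean`,
`missingUpperBoundAt_of_ram_of_not_alpha_of_shape_pub_odd`; kernel `X11b/Three/UpperHalfShimuraCore.lean`) TRANSPLANTED to the
W-ALL leaf Gss2 (`E` non-CM, ADDITIVE of cell `(G) ∧ ss` at `3`, `r_an = 1`). Differences, all bookkeeping: (i) the BSD prime `3` is
additive, never a carrier (`3 ∣ c_q ⇒ q` split multiplicative is the SHAPE hypothesis, which at `q = 3` reads `3 ∤ c₃`, true on the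
leaf: Kodaira `I₀*`), never in `N⁻`, and splits in the field; (ii) the parametrisation datum with `3 ∤ c` is GIVEN (on the leaf it is
the lattice-optimal datum of the optimal member, `RamifiedPairUpperBound.not_three_dvd_c_of_latticeOptimal_of_subGss`); (iii) the
rank-zero partner `E^{(d_K)}` is again a LEAF curve (`LeafShimuraInert.leaf_twist_of_split_three`), so its `≥`-half is the route member
L₀ `Gss2LowerAtThreeRankZero` (or any partner-lower certificate) instead of Skinner 2016 Thm. C — asked here as a hypothesis, see §2; (iv) the degree identity (DEG) is
taken from ONE of three printed mechanisms (Pasten Lemma 6.15: a (ram) witness inside `N⁻`; Lemma 6.16: a witness and one more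
multiplicative prime outside; Lemma 6.18 = Papikian–Rabinoff: a carrier pair with an odd member `≢ 1 (mod 3)`), since the X11b device
«the BSD prime itself is a multiplicative prime outside `N⁻`» is unavailable; (v) the field is a DATUM (imaginary quadratic, ODD
discriminant, the inert set `S` inert and unramified, every other bad prime split, `L(E^{(d_K)},1) ≠ 0`) — supplied class-wide by
`friedbergHoffstein_exists_twist_ne_zero_inertAt` when `2 ∣ N_E` (then `d_K` is odd), see §2.

* §1 `leafRankOneUpper_three_of_shimuraInertDatum` — THE CORE: U₁ at a leaf curve `W` carrying a datum with `3 ∤ c`, from the named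
  facts {GZK, modularity, Jacquet–Langlands, Pasten 2024 §6 component orders, CST14 Thm 1.5 + JSW17 Thm 4.4.1}, an even set `S` of
  multiplicative primes containing every split-multiplicative carrier, SHAPE, (DEG)-availability, ONE JSW field datum, and the
  partner's lower half at that field.
* §2 `leafRankOneUpper_three_of_shimuraInert_of_partnerLower_of_two_dvd` — the field discharged by Friedberg–Hoffstein (inert form)
  when `2 ∣ N_E`; the partner's lower half asked for every imaginary quadratic `K` with odd `d_K` in which `3` splits (it is paid
  by the route member L₀ in part 3, `…LeafRankOneUpperAtThreeShimuraInertOfLowerRankZero.lean`).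

NET (mod print): on the «Shimura rows» (SHAPE ∧ DEG-availability; census: 123 of the 238 multi-carrier rank-one Gss2 classes with
`N < 5·10⁵`, 116 without the `q = 2` cokernel clause, 93 of them with `2 ∣ N`) U₁ ⟸ partner-lower (⟸ L₀), with NO Σ-type input.
References: [cite: JetchevSkinnerWan2017, §7.4.2 (p. 31), Thm. 4.4.1 (p. 19)] [cite: CaiShuTian2014, Thm. 1.5]
[cite: PastenShimura2024, Prop. 6.13, Lemmas 6.8, 6.14–6.16, 6.18, §6.9 (pp. 22–25)] [cite: PapikianRabinoff2016, Cor. 3.5]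
[cite: FriedbergHoffstein1995, Thm. B] [cite: Miller2011LMS, Def. 1.1] [cite: GrossZagier1986, I.(6.5)].
-/

-- D-0017: single-problem summit, so `Summit.BirchSwinnertonDyer.BirchSwinnertonDyer.…` repeats a namespace BY DESIGN.
set_option linter.dupNamespace false
set_option autoImplicit false

noncomputable section

open scoped Classical NumberField

open WeierstrassCurve NumberField IsDedekindDomain Literature.NumberTheory.EllipticCurves
  Rat.HeightOneSpectrum CongruenceSubgroup
  Literature.NumberTheory.EllipticCurves.ModularForms
  Literature.NumberTheory.EllipticCurves.Rank1Residual
  Literature.NumberTheory.EllipticCurves.Rank1Residual.Typed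
  Literature.NumberTheory.QuadraticFields.Quadratic
  Literature.NumberTheory.Automorphic
  Summit.BirchSwinnertonDyer.Rank1Residual
  Summit.BirchSwinnertonDyer.Rank1Residual.Additive
  Summit.BirchSwinnertonDyer.Rank1Residual.X11b
  Summit.BirchSwinnertonDyer.Rank1Residual.X11b.Three
  Summit.BirchSwinnertonDyer.BirchSwinnertonDyer.Theorems

namespace Summit.BirchSwinnertonDyer.BirchSwinnertonDyer.Theorems.LeafShimuraInert

/-! ## §1 The core: U₁ at ONE Jetchev–Skinner–Wan datum of a leaf curve carrying a datum with `3 ∤ c` -/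

/-- **U₁ AT A LEAF CURVE FROM ONE JETCHEV–SKINNER–WAN DATUM — the inert-carrier (Shimura-curve) road, core.** Data: `W/ℚ` globally
minimal, non-CM, additive of cell `(G) ∧ ss` at `3` (`Addv W 3`, `SubGss W 3`), `r_an = 1`, with a parametrisation datum `Dt` at level
`N_W` whose constant is a `3`-unit; an EVEN set `S` of multiplicative primes of `W` such that every split-multiplicative prime outside
`S` has `3 ∤ ord_ℓ Δ_min` (all carriers inside); SHAPE «`3 ∣ c_q(W) ⇒ q` split multiplicative» (no additive `IV/IV*` carrier; at
`q = 3` it says `3 ∤ c₃`, true on the leaf); (DEG)-availability in one of the three printed forms (a (ram) witness `ℓ₀ ∈ S` with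
`3 ∤ ord_{ℓ₀}Δ`; or such an `ℓ₀ ∉ S` and another multiplicative `t ∉ S`; or `S = {q₁,q₂}` with `q₂` odd, `q₂ ≢ 1 (mod 3)`); an imaginary
quadratic `K` of ODD discriminant with `S` inert and unramified, every other prime of `N_W` split, `L(W^{(d_K)},1) ≠ 0`; and the LOWER
half `Typed.MissingLowerBoundAt Wd 3` of every globally minimal model `Wd` of `W^{(d_K)}`. Named facts: `hGZK`, `hmod`, `hnf`, `hJL`
(Jacquet–Langlands), `hCO` (Pasten 2024 §6 component orders), `hHK` (CST14 Thm. 1.5 + JSW17 Thm. 4.4.1 on `X_{N⁺,N⁻}`). CONCLUSION: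
`Typed.MissingUpperBoundAt W 3`. Proof = x11b3's `missingUpperBoundAt_of_ram_of_not_alpha_of_shape_pub_odd` with the changes (i)–(v)
of the module docstring; the bookkeeping core is `X11b.missingUpperBoundAt_of_shimuraShapes`. CONDITIONAL; nothing booked.
-- adapted from Summits/BirchSwinnertonDyer/BirchSwinnertonDyer/Theorems/ClassRecordThreeShimuraUpperHalf.lean
[cite: JetchevSkinnerWan2017, §7.4.2 (pp. 30–31) and Thm. 4.4.1 (p. 19)] [cite: CaiShuTian2014, Thm. 1.5]
[cite: PastenShimura2024, Prop. 6.13, Lemmas 6.8, 6.14–6.16, 6.18 (pp. 22–25)] [cite: PapikianRabinoff2016, Cor. 3.5]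
[cite: Miller2011LMS, Def. 1.1] -/
theorem leafRankOneUpper_three_of_shimuraInertDatum
    -- published inputs (named facts of the tree)
    (hGZK : rank_eq_analyticRank_of_analyticRank_le_one) (hmod : hasEntireLFunction_rat)
    (hnf : exists_isNewformOf) (hJL : nonempty_shimuraParametrizationData)
    (hCO : PastenShimura2024_componentOrders)
    (hHK : shimuraCurve_heegnerPoint_grossZagier_kolyvagin)
    -- the leaf curve, with a datum whose constant is a `3`-unit
    (W : WeierstrassCurve ℚ) [W.IsElliptic] [W.IsGloballyMinimal]
    (hadd : Addv W 3) (hsub : SubGss W 3) (hr : W.analyticRank = 1)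
    {N : ℕ} [NeZero N] (hN : W.conductorNorm ℤ = N)
    (Dt : ModularParametrizationData W N) (hc : ¬ (3 : ℤ) ∣ Dt.c)
    -- the inert set: even, multiplicative, every split-multiplicative carrier inside
    (S : Finset ℕ) (hSeven : Even S.card)
    (hSmult : ∀ ℓ ∈ S, ∃ _ : Fact ℓ.Prime, W.HasMultiplicativeReductionAtPrime ℓ)
    (hFC : ∀ (ℓ : ℕ) [Fact ℓ.Prime], ℓ ∉ S → W.HasSplitMultiplicativeReductionAtPrime ℓ →
      ¬ 3 ∣ padicValInt ℓ W.minimalDiscriminantInt)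
    -- SHAPE: every Tamagawa-`3` carrier is split multiplicative
    (hshape : ∀ (q : ℕ) [Fact q.Prime], 3 ∣ (W.baseChange ℚ_[q]).localTamagawaNumber ℤ_[q] →
      W.HasSplitMultiplicativeReductionAtPrime q)
    -- (DEG)-availability: Pasten Lemma 6.15 | Lemma 6.16 | Lemma 6.18 (Papikian–Rabinoff)
    (hDEG : (∃ ℓ₀ ∈ S, ¬ 3 ∣ padicValInt ℓ₀ W.minimalDiscriminantInt) ∨
      (∃ ℓ₀ t : ℕ, ∃ _ : Fact ℓ₀.Prime, ∃ _ : Fact t.Prime,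
        W.HasMultiplicativeReductionAtPrime ℓ₀ ∧ W.HasMultiplicativeReductionAtPrime t ∧
        ℓ₀ ∉ S ∧ t ∉ S ∧ t ≠ ℓ₀ ∧ ¬ 3 ∣ padicValInt ℓ₀ W.minimalDiscriminantInt) ∨
      (∃ q₁ q₂ : ℕ, S = {q₁, q₂} ∧ q₁ ≠ q₂ ∧ q₂ ≠ 2 ∧ q₂ % 3 ≠ 1))
    -- ONE Jetchev–Skinner–Wan field datum, `d_K` odd
    (K : Type) [Field K] [NumberField K] (hK : IsImaginaryQuadratic K) (hodd : Odd (NumberField.discr K))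
    (hinert : ∀ ℓ ∈ S, ((Ideal.span {(ℓ : ℤ)}).primesOver (𝓞 K)).ncard = 1 ∧ ¬ (ℓ : ℤ) ∣ NumberField.discr K)
    (hsplitN : ∀ ℓ : ℕ, ℓ.Prime → ℓ ∣ W.conductorNorm ℤ → ℓ ∉ S →
      ((Ideal.span {(ℓ : ℤ)}).primesOver (𝓞 K)).ncard = 2)
    (hLt : (W.quadraticTwist (NumberField.discr K : ℚ)).entireLFunction 1 ≠ 0)
    -- the partner's LOWER half at this field
    (hPL : ∀ (Wd : WeierstrassCurve ℚ) [Wd.IsElliptic] [Wd.IsGloballyMinimal] (Cd : VariableChange ℚ),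
      Cd • W.quadraticTwist (NumberField.discr K : ℚ) = Wd → Typed.MissingLowerBoundAt Wd 3) :
    Typed.MissingUpperBoundAt W 3 := by
  subst hN
  haveI h3F : Fact (Nat.Prime 3) := ⟨Nat.prime_three⟩
  have hNS : integral_neronScaling_of_isGloballyMinimal :=
    integral_neronScaling_of_isGloballyMinimal_holds
  have hp : (3 : ℕ).Prime := Nat.prime_three
  have hp2 : (3 : ℕ) ≠ 2 := by decide
  have hirr : W.HasIrreducibleModPGaloisRep 3 := Additive.irr_of_subGss_of_ne_two W 3 hp2 hadd hsub
  have hbad3 : ¬ W.HasGoodReductionAtPrime 3 := not_good_of_addv W 3 hadd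
  have hnm3 : ¬ W.HasMultiplicativeReductionAtPrime 3 := not_mult_of_addv W 3 hadd
  -- the sign of the functional equation is `−1` (modularity, `r_an = 1`)
  have hw : W.rootNumber = -1 := by
    rw [WeierstrassCurve.rootNumber_eq_neg_one_pow_analyticRank_of_exists_isNewformOf hnf W, hr]
    norm_num
  have hN0 : W.conductorNorm ℤ ≠ 0 := (W.conductorNorm_pos_holds).ne'
  haveI : NeZero (W.conductorNorm ℤ) := ⟨hN0⟩
  have hNpos : 0 < W.conductorNorm ℤ := W.conductorNorm_pos_holds
  -- the set of multiplicative primes and the Pasten package with (P618)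
  set Mlt : Finset ℕ := (W.conductorNorm ℤ).primeFactors.filter
    (fun q ↦ ∃ h : q.Prime, @WeierstrassCurve.HasMultiplicativeReductionAtPrime W q ⟨h⟩) with hMlt
  have hmemMlt : ∀ {q : ℕ} [hq : Fact q.Prime], W.HasMultiplicativeReductionAtPrime q → q ∈ Mlt := by
    intro q hq hm
    have hqN : q ∣ W.conductorNorm ℤ :=
      (W.dvd_conductorNorm_iff_not_hasGoodReductionAtPrime q).mpr
        (WeierstrassCurve.HasMultiplicativeReduction.not_hasGoodReduction (R := ℤ_[q]) hm)
    exact Finset.mem_filter.mpr ⟨Nat.mem_primeFactors.mpr ⟨hq.out, hqN, hN0⟩, hq.out, hm⟩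
  have hMlt_exact : ∀ q ∈ Mlt, q.Prime ∧ q ∣ W.conductorNorm ℤ ∧ ¬ q ^ 2 ∣ W.conductorNorm ℤ := by
    intro q hq
    obtain ⟨hqN, hqp, hm⟩ := Finset.mem_filter.mp hq
    haveI : Fact q.Prime := ⟨hqp⟩
    exact ⟨hqp, (Nat.mem_primeFactors.mp hqN).2.1, not_sq_dvd_conductorNorm_of_mult W q hm⟩
  -- the optimal classical datum of the class (Modularity) and the Pasten package (named facts)
  obtain ⟨W₀, hW₀, hW₀m, D₀, hfW, hisoW, hmin⟩ :=
    exists_optimal_modularParametrizationData_of_modularity hnf (W.conductorNorm ℤ) W rfl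
  obtain ⟨δ, cA, ι, κ, hδ0, hδ, hcA, hanchor, h613, hij, h68, hEis, h618⟩ :=
    ribetTakahashiPackageCoker_of_componentOrders hCO PastenShimura2024_lemma_6_8_isogeny_holds hJL W 3 hirr
      (W.conductorNorm ℤ) W₀ D₀ rfl hfW hmin
  obtain ⟨hvA, hι⟩ := rtPackage_valuation_forms W 3 hirr hcA h68 hEis
  -- the inert set sits inside the multiplicative primes and avoids `3`
  have hSMlt : S ⊆ Mlt := by
    intro ℓ hℓ
    obtain ⟨hℓF, hm⟩ := hSmult ℓ hℓ
    exact @hmemMlt ℓ hℓF hm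
  have hpS : 3 ∉ S := by
    intro h
    obtain ⟨_, hm⟩ := hSmult 3 h
    exact hnm3 hm
  -- (DEG) from one of the three printed mechanisms
  have hdeg : padicValNat 3 (δ ∅) =
      padicValNat 3 (δ S) + ∑ x ∈ S, padicValNat 3 (padicValInt x W.minimalDiscriminantInt) := by
    rcases hDEG with ⟨ℓ₀, hℓ₀S, hram₀⟩ | ⟨ℓ₀, t, hℓ₀F, htF, hm₀, hmt, hℓ₀S, htS, htℓ, hram₀⟩ |
        ⟨q₁, q₂, hSeq, hne, hq₂2, hq₂1⟩
    · obtain ⟨n, hn⟩ := hSeven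
      exact RTDegree.padicValNat_delta_empty_eq_of_witness_mem h613 hδ hcA hij hvA hι
        (padicValNat.eq_zero_of_not_dvd hram₀) n S hSMlt (by omega) (Or.inr hℓ₀S)
    · haveI := hℓ₀F; haveI := htF
      exact RTDegree.padicValNat_delta_empty_eq_of_witness h613 hδ hcA hij hvA hι hSMlt hSeven
        (hmemMlt hm₀) (padicValNat.eq_zero_of_not_dvd hram₀) (hmemMlt hmt) htS htℓ
    · have hq₁ : q₁ ∈ Mlt := hSMlt (by rw [hSeq]; simp)
      have hq₂ : q₂ ∈ Mlt := hSMlt (by rw [hSeq]; simp)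
      have h31 : ¬ 3 ∣ q₂ - 1 := by
        intro h
        have hq₂p : q₂.Prime := (hMlt_exact q₂ hq₂).1
        have h2le : 2 ≤ q₂ := hq₂p.two_le
        omega
      have h := padicValNat_delta_empty_eq_of_pair_coker (c := fun x ↦ padicValInt x W.minimalDiscriminantInt)
        h613 hδ hcA hij hvA hι h618 hq₁ hq₂ hne hq₂2 h31
      have hSeq' : S = insert q₁ (insert q₂ ∅) := by rw [hSeq]; rfl
      rw [hSeq']
      exact h
  -- field data
  have h2 := hK.1
  have hd4 : NumberField.discr K % 4 = 1 := discr_emod_four_eq_one hK.1 hodd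
  have h3N : 3 ∣ W.conductorNorm ℤ := (W.dvd_conductorNorm_iff_not_hasGoodReductionAtPrime 3).mpr hbad3
  have hps2 : ((Ideal.span {((3 : ℕ) : ℤ)}).primesOver (𝓞 K)).ncard = 2 := hsplitN 3 hp h3N hpS
  have hps : SplitsIn K 3 := hps2
  have hH3 : SatisfiesHeegnerHypothesis 3 K := fun q hq hq3 ↦ by
    have : q = 3 := (Nat.prime_dvd_prime_iff_eq hq hp).mp hq3
    subst this; exact hps2
  have hpd : ¬ ((3 : ℕ) : ℤ) ∣ NumberField.discr K := not_dvd_discr_of_splitsIn h2 hp hps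
  -- `d_K < -4` (odd, `≠ -3`), so `w_K = 2` is prime to `3`
  have hμ : ¬ 3 ∣ Units.torsionOrder K := by
    haveI : IsTotallyComplex K := hK.2
    have hneg : NumberField.discr K < 0 := discr_neg_of_finrank_eq_two K hK.1
    have h3d : NumberField.discr K ≠ -3 := by
      intro h; apply hpd; rw [h]; norm_num
    have h4 : NumberField.discr K < -4 := by omega
    rw [Literature.NumberTheory.DiophantineGeometry.torsionOrder_eq_two_of_discr_lt hK.1 h4]
    decide
  have hSin : ∀ ℓ ∈ S, ∃ _ : Fact ℓ.Prime, Mult W ℓ ∧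
      ((ℓ ≠ 2 ∧ jacobiSym (NumberField.discr K) ℓ = -1) ∨ (ℓ = 2 ∧ NumberField.discr K % 8 = 5)) := by
    intro ℓ hℓ
    obtain ⟨hℓF, hm⟩ := hSmult ℓ hℓ
    obtain ⟨hn, hd⟩ := hinert ℓ hℓ
    refine ⟨hℓF, hm, ?_⟩
    have hn' : ((Ideal.span {(ℓ : ℤ)}).primesOver (𝓞 K)).ncard ≠ 2 := by rw [hn]; decide
    by_cases hℓ2 : ℓ = 2
    · subst hℓ2
      have hn2 : ((Ideal.span {(2 : ℤ)}).primesOver (𝓞 K)).ncard ≠ 2 := by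
        simpa only [Nat.cast_ofNat] using hn'
      have hd2 : ¬ (2 : ℤ) ∣ NumberField.discr K := by simpa only [Nat.cast_ofNat] using hd
      exact Or.inr ⟨rfl, discr_emod_eight_eq_five_of_ncard_ne_two h2 hn2 hd2⟩
    · exact Or.inl ⟨hℓ2, jacobiSym_discr_eq_neg_one_of_ncard_ne_two h2 hℓF.out hℓ2 hn' hd⟩
  have hsplit : ∀ (ℓ : ℕ) [Fact ℓ.Prime], ¬ W.HasGoodReductionAtPrime ℓ → ℓ ∉ S →
      IsSquare (algebraMap ℚ ℚ_[ℓ] (NumberField.discr K : ℚ)) := by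
    intro ℓ hℓF hg hℓS
    have hℓN : ℓ ∣ W.conductorNorm ℤ := (W.dvd_conductorNorm_iff_not_hasGoodReductionAtPrime ℓ).mpr hg
    exact isSquare_discr_padic_of_ncard_eq_two h2 ℓ (hsplitN ℓ hℓF.out hℓN hℓS)
  -- `d_K` odd: the ramified primes of `K` are good primes `≥ 5` (`2 ∤ d_K`, `3 ∤ d_K`)
  have hdodd : ¬ (2 : ℤ) ∣ NumberField.discr K := by
    obtain ⟨k, hk⟩ := hodd
    omega
  have h5 : ∀ (q : ℕ) [Fact q.Prime], (q : ℤ) ∣ NumberField.discr K → W.HasGoodReductionAtPrime q →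
      5 ≤ q ∨ 5 ≤ 3 := by
    intro q hqF hqd _
    have hq : q.Prime := hqF.out
    have hq2 : q ≠ 2 := by
      rintro rfl
      exact hdodd (by exact_mod_cast hqd)
    have hq3 : q ≠ 3 := by
      rintro rfl
      exact hpd hqd
    exact Or.inl (hq.five_le_of_ne_two_of_ne_three hq2 hq3)
  -- a globally minimal model of the twist, differing from the twisted equation by a `3`-unit; it is a rank-zero LEAF curve
  have hD0 : (NumberField.discr K : ℚ) ≠ 0 := by exact_mod_cast NumberField.discr_ne_zero K
  haveI hEt : (W.quadraticTwist (NumberField.discr K : ℚ)).IsElliptic :=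
    W.isElliptic_quadraticTwist hD0
  obtain ⟨Cd, hCd⟩ := hasGlobalMinimalModel_rat_holds (W.quadraticTwist (NumberField.discr K : ℚ))
  haveI : (Cd • W.quadraticTwist (NumberField.discr K : ℚ)).IsGloballyMinimal := hCd
  set Wd : WeierstrassCurve ℚ := Cd • W.quadraticTwist (NumberField.discr K : ℚ) with hWd_def
  have hWd : Cd • W.quadraticTwist (NumberField.discr K : ℚ) = Wd := rfl
  have hu : padicValRat 3 (Cd.u : ℚ) = 0 :=
    padicValRat_u_eq_zero_of_twist_minimal_of_splitsIn W 3 K h2 hps Cd hWd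
  -- torsion: `3 ∤ #E(ℚ)_tors`, `3 ∤ #E^{d}(ℚ)_tors`
  have htW : ¬ 3 ∣ W.torsionOrder := not_dvd_torsionOrder_of_irr W 3 hirr
  have hirrd : Wd.HasIrreducibleModPGaloisRep 3 :=
    hasIrreducibleModPGaloisRep_twist_model W 3 K h2 hirr Cd hWd
  have htd : ¬ 3 ∣ Wd.torsionOrder := not_dvd_torsionOrder_of_irr Wd 3 hirrd
  -- the rank-0 twist's algebraic central value (modular symbols) and its analytic rank
  have hmodP : nonempty_modularParametrizationData :=
    nonempty_modularParametrizationData_iff_exists_isNewformOf_unconditional.mpr hnf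
  obtain ⟨qd, hqd⟩ :=
    Summit.BirchSwinnertonDyer.Rank1Residual.X1.RankZeroPartner.exists_rat_entireLFunction_one_div_realPeriodRat
      hmodP Wd
  have hLt' : (W.quadraticTwist (NumberField.discr K : ℚ)).entireLFunction = Wd.entireLFunction := by
    rw [← hWd, entireLFunction_smul]
  have hLd1 : Wd.entireLFunction 1 ≠ 0 := by rw [← hLt']; exact hLt
  have hrd : Wd.analyticRank = 0 := (Wd.analyticRank_eq_zero_iff_holds (hmod Wd)).2 hLd1
  have hfinSd : Wd.ShaFinite := (hGZK Wd (by rw [hrd]; omega)).2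
  have hfinW : W.ShaFinite := (hGZK W (by omega)).2
  ---------------------------------------------------------------- the Shimura curve `X_{N⁺,N⁻}`, `N⁻ = ∏ S`, and its class-minimal datum
  obtain ⟨X, W', hW', P₀, hP₀, hdegδ⟩ := hanchor hSMlt hSeven
  haveI := hW'
  ---------------------------------------------------------------- the Heegner point of `X_{N⁺,N⁻}` at `K` (named fact)
  have hSin' : ∀ ℓ ∈ S, ℓ.Prime ∧ ℓ ∣ W.conductorNorm ℤ ∧ ¬ ℓ ^ 2 ∣ W.conductorNorm ℤ ∧
      ((Ideal.span {(ℓ : ℤ)}).primesOver (𝓞 K)).ncard = 1 ∧ ¬ (ℓ : ℤ) ∣ NumberField.discr K := by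
    intro ℓ hℓ
    obtain ⟨h1, h2', h3⟩ := hMlt_exact ℓ (hSMlt hℓ)
    obtain ⟨hn, hd⟩ := hinert ℓ hℓ
    exact ⟨h1, h2', h3, hn, hd⟩
  obtain ⟨P, degS, hdegS, hlinkS, hGZP, hUShP⟩ :=
    hHK W 3 (W.conductorNorm ℤ) K S Dt X W' P₀ rfl hp2 hirr hK hSeven hSin' hsplitN hps2 hP₀
  -- the two degree links
  have hlink₁ : padicValNat 3 Dt.modularDegree = padicValNat 3 (δ ∅) := by
    rw [hδ0]; exact padicValNat_modularDegree_eq_of_isNewformOf hNS hisoW D₀ hfW hmin hp hirr Dt hc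
  have hlink₂ : padicValNat 3 degS = padicValNat 3 (δ S) := by rw [hlinkS, hdegδ]
  ---------------------------------------------------------------- covolume form (Zagier) and (U-Sh) (non-torsion)
  have hGZR := degS_mul_lDerivEK_eq_of_petersson W (W.conductorNorm ℤ) K Dt P hdegS hGZP
  have hUSh : Nat.card (AddCommGroup.primaryComponent (W.baseChange K).sha 3) ≤
      3 ^ (2 * padicValNat 3 (AddSubgroup.zmultiples P).index) :=
    hUShP (not_isOfFinAddOrder_of_petersson_display hmod W K hr hLt P _ _ hGZP)
  -- (GZ-Sh₀) from (GZ-Sh-ℝ), then the links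
  obtain ⟨qE, hqE, hqd0, hE, h0⟩ := gzShape₀_of_shimuraGZReal W 3 (W.conductorNorm ℤ) K Dt P degS
    hGZK hmod hK hp2 hc hμ hr hLt hdegS hGZR Wd Cd hWd hu qd hqd htW htd
  have h₀ : (2 * padicValNat 3 (AddSubgroup.zmultiples P).index : ℤ) + padicValNat 3 (δ ∅) =
      padicValRat 3 qE + padicValRat 3 qd + padicValNat 3 (δ S) := by
    rw [← hlink₁, ← hlink₂]; exact h0
  -- (GZ-Sh) = (GZ-Sh₀) + (DEG)
  have hGZSh : ∃ qE qd : ℚ, qE ≠ 0 ∧ qd ≠ 0 ∧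
      W.leadingLCoeff / ((W.realPeriodRat : ℂ) * (W.regulator : ℂ)) = (qE : ℂ) ∧
      Wd.entireLFunction 1 / (Wd.realPeriodRat : ℂ) = (qd : ℂ) ∧
      (2 * padicValNat 3 (AddSubgroup.zmultiples P).index : ℤ) +
          (∑ ℓ ∈ S, padicValNat 3 (padicValInt ℓ W.minimalDiscriminantInt) : ℕ) =
        padicValRat 3 qE + padicValRat 3 qd :=
    ⟨qE, qd, hqE, hqd0, hE, hqd, gzShape_of_gzShape₀_of_deg h₀ hdeg⟩
  ---------------------------------------------------------------- the numeric Tamagawa condition and the partner's lower half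
  have hT := padicValNat_tamagawaProduct_add_twist_le_of_inertSet'_odd W 3 hp2 K h2 hdodd h5 hshape Cd hWd S
    hSin (fun ℓ _ hg hℓS ↦ hsplit ℓ hg hℓS) (fun ℓ _ hℓS hs ↦ hFC ℓ hℓS hs)
  have htw := twistLowerShape_of_missingLowerBoundAt_rankZero hGZK Wd hrd hqd0 hqd (hPL Wd Cd hWd)
  exact missingUpperBoundAt_of_shimuraShapes W 3 hp2 K h2 Wd ⟨Cd, hWd⟩ hfinW hfinSd P _ hT htw hGZSh hUSh

/-! ## §2 The field by Friedberg–Hoffstein (inert form) when `2 ∣ N_E`; the partner's lower half asked at every odd split-`3` field -/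

/-- **U₁ at a leaf curve with `2 ∣ N_E` on a «Shimura row», from published facts + the partner-lower supply.** As §1, with the
Jetchev–Skinner–Wan field SUPPLIED by `friedbergHoffstein_exists_twist_ne_zero_inertAt` (root number `−1` by modularity; `S` inert,
every other bad prime split, `L(W^{(d_K)},1) ≠ 0`); `d_K` is then ODD because the bad prime `2` is inert or split
(`X11b.Three.odd_discr_of_two_dvd`). The partner's lower half is asked for every imaginary quadratic `K` of odd discriminant in
which `3` splits with `L(W^{(d_K)},1) ≠ 0` and every globally minimal model of the twist — the shape the route member L₀ pays (part 3).
CONDITIONAL; nothing booked. [cite: FriedbergHoffstein1995, Thm. B] [cite: JetchevSkinnerWan2017, §7.4.2 (p. 31), Thm. 4.4.1 (p. 19)]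
[cite: PastenShimura2024, Prop. 6.13, Lemmas 6.15–6.16, 6.18 (pp. 23–25)] [cite: Serre1973, Ch. II §3.3 Thms 3–4] -/
theorem leafRankOneUpper_three_of_shimuraInert_of_partnerLower_of_two_dvd
    -- published inputs (named facts of the tree)
    (hGZK : rank_eq_analyticRank_of_analyticRank_le_one) (hmod : hasEntireLFunction_rat)
    (hnf : exists_isNewformOf) (hJL : nonempty_shimuraParametrizationData)
    (hCO : PastenShimura2024_componentOrders)
    (hHK : shimuraCurve_heegnerPoint_grossZagier_kolyvagin)
    (hFH : friedbergHoffstein_exists_twist_ne_zero_inertAt)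
    -- the leaf curve with `2 ∣ N_E`, with a datum whose constant is a `3`-unit
    (W : WeierstrassCurve ℚ) [W.IsElliptic] [W.IsGloballyMinimal]
    (hadd : Addv W 3) (hsub : SubGss W 3) (hr : W.analyticRank = 1) (h2N : 2 ∣ W.conductorNorm ℤ)
    {N : ℕ} [NeZero N] (hN : W.conductorNorm ℤ = N)
    (Dt : ModularParametrizationData W N) (hc : ¬ (3 : ℤ) ∣ Dt.c)
    -- the inert set, SHAPE and (DEG)-availability, as in §1
    (S : Finset ℕ) (hSeven : Even S.card)
    (hSmult : ∀ ℓ ∈ S, ∃ _ : Fact ℓ.Prime, W.HasMultiplicativeReductionAtPrime ℓ)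
    (hFC : ∀ (ℓ : ℕ) [Fact ℓ.Prime], ℓ ∉ S → W.HasSplitMultiplicativeReductionAtPrime ℓ →
      ¬ 3 ∣ padicValInt ℓ W.minimalDiscriminantInt)
    (hshape : ∀ (q : ℕ) [Fact q.Prime], 3 ∣ (W.baseChange ℚ_[q]).localTamagawaNumber ℤ_[q] →
      W.HasSplitMultiplicativeReductionAtPrime q)
    (hDEG : (∃ ℓ₀ ∈ S, ¬ 3 ∣ padicValInt ℓ₀ W.minimalDiscriminantInt) ∨
      (∃ ℓ₀ t : ℕ, ∃ _ : Fact ℓ₀.Prime, ∃ _ : Fact t.Prime,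
        W.HasMultiplicativeReductionAtPrime ℓ₀ ∧ W.HasMultiplicativeReductionAtPrime t ∧
        ℓ₀ ∉ S ∧ t ∉ S ∧ t ≠ ℓ₀ ∧ ¬ 3 ∣ padicValInt ℓ₀ W.minimalDiscriminantInt) ∨
      (∃ q₁ q₂ : ℕ, S = {q₁, q₂} ∧ q₁ ≠ q₂ ∧ q₂ ≠ 2 ∧ q₂ % 3 ≠ 1))
    -- the partner-lower supply: every odd imaginary quadratic field with `3` split and `L(E^{d},1) ≠ 0`
    (hPL : ∀ (K : Type) [Field K] [NumberField K], IsImaginaryQuadratic K → Odd (NumberField.discr K) →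
      SatisfiesHeegnerHypothesis 3 K → (W.quadraticTwist (NumberField.discr K : ℚ)).entireLFunction 1 ≠ 0 →
      ∀ (Wd : WeierstrassCurve ℚ) [Wd.IsElliptic] [Wd.IsGloballyMinimal] (Cd : VariableChange ℚ),
        Cd • W.quadraticTwist (NumberField.discr K : ℚ) = Wd → Typed.MissingLowerBoundAt Wd 3) :
    Typed.MissingUpperBoundAt W 3 := by
  haveI h3F : Fact (Nat.Prime 3) := ⟨Nat.prime_three⟩
  have hp : (3 : ℕ).Prime := Nat.prime_three
  -- the sign of the functional equation is `−1` (modularity, `r_an = 1`)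
  have hw : W.rootNumber = -1 := by
    rw [WeierstrassCurve.rootNumber_eq_neg_one_pow_analyticRank_of_exists_isNewformOf hnf W, hr]
    norm_num
  -- the field of JSW §7.4.2 (Friedberg–Hoffstein, inert form)
  obtain ⟨K, _, _, hK, -, hinert, hsplitN, hLt⟩ := hFH W hw S hSmult hSeven 4
  have hodd : Odd (NumberField.discr K) := X11b.Three.odd_discr_of_two_dvd W hK.1 hinert hsplitN h2N
  -- `3` splits (it is a bad prime outside `S`)
  have hbad3 : ¬ W.HasGoodReductionAtPrime 3 := not_good_of_addv W 3 hadd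
  have h3S : 3 ∉ S := by
    intro h
    obtain ⟨_, hm⟩ := hSmult 3 h
    exact not_mult_of_addv W 3 hadd hm
  have h3N : 3 ∣ W.conductorNorm ℤ := (W.dvd_conductorNorm_iff_not_hasGoodReductionAtPrime 3).mpr hbad3
  have hH3 : SatisfiesHeegnerHypothesis 3 K := fun q hq hq3 ↦ by
    have : q = 3 := (Nat.prime_dvd_prime_iff_eq hq hp).mp hq3
    subst this; exact hsplitN 3 hp h3N h3S
  exact leafRankOneUpper_three_of_shimuraInertDatum hGZK hmod hnf hJL hCO hHK W hadd hsub hr hN Dt hc S hSeven hSmult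
    hFC hshape hDEG K hK hodd hinert hsplitN hLt (fun Wd _ _ Cd hWd ↦ hPL K hK hodd hH3 hLt Wd Cd hWd)

end Summit.BirchSwinnertonDyer.BirchSwinnertonDyer.Theorems.LeafShimuraInert

end
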